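import Literature.AlgebraicGeometry.Modules.SheafHom
import Literature.AlgebraicGeometry.Modules.AffineLocalizing
import Literature.AlgebraicGeometry.Modules.CokernelSupport
import HarnessLib

/-!
# Sections of `𝓗om(P, G)` over an affine open: `Hom(P|_V, G|_V) = Hom_{𝒪(V)}(Γ(V, P), Γ(V, G))`

Hartshorne, *Algebraic Geometry*, II Prop. 5.2 (a)/(d) and Ex. 5.3: on an affine scheme
`V = Spec B` the functor `M ↦ M̃` is fully faithful on `B`-modules and a quasi-coherent module is
determined by its global sections; in particular `Hom_{𝒪_V}(M̃, 𝓖) = Hom_B(M, Γ(V, 𝓖))`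
(The Stacks Project, Tag 01I7: `Hom_{𝒪_X}(M̃, 𝓖) = Hom_R(M, Γ(X, 𝓖))` for `X = Spec R` and ANY
`𝒪_X`-module `𝓖`). This file proves the corresponding statement in the affine-local language of the
tree (`Modules/AffineLocalizing`: numerators and torsion on principal opens, Hartshorne II Lemma 5.3)
and of the tree's internal Hom (`Modules/SheafHom`: sections of `𝓗om(P, G)` over `V` are the
morphisms `P|_V ⟶ G|_V` of restricted modules):

* `evalHom V : (P|_V ⟶ G|_V) →ₗ[𝒪(V)] (Γ(V, P) →ₗ[𝒪(V)] Γ(V, G))` — evaluation on `V`-sections;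
* `evalHom_injective` — **injective** for `P` affine-localizing and `V` affine (a morphism killing all
  sections over `V` kills all sections over the principal opens `D(g) ⊆ V`, which are fractions
  `x|_{D(g)}/gⁿ`, hence all sections, `G` being a sheaf);
* `homOfLinear`, `evalHom_homOfLinear`, `evalHom_surjective`, `evalHom_bijective` — **surjective**:
  a `B`-linear `ℓ : Γ(V, P) → Γ(V, G)` extends uniquely to `P|_V ⟶ G|_V`, with value at a section `s`
  over `W ⊆ V` glued (in the sheaf `G`) from the values `ℓ(x)|_{D(g)}/gⁿ` on the principal opens
  `D(g) ⊆ W`, `x|_{D(g)} = gⁿ s|_{D(g)}` (well defined by the torsion property of `P`);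
* `evalHom_restrictHom_apply` — compatibility of evaluation with restriction to smaller opens.

Used by `Modules/SheafHomCoh` (coherence of `𝓗om(P, G)` for coherent `P`, `G`) and by the proof of
the full faithfulness half of Grothendieck's existence theorem (`Morphisms/FormalModuleHomCoh`).
Everything is proved; no named facts.

## References

* R. Hartshorne, *Algebraic Geometry*, GTM 52 (1977): II Prop. 5.2, Lemma 5.3, Ex. 5.3
  (pp. 110–113, 124). [Hartshorne1977]
* The Stacks Project, Tag 01I7 (Schemes, Lemma 26.7.1). [StacksProject]
-/

noncomputable section

-- `TopCat.Presheaf`/`TopCat.Sheaf` are not reducible (as in Mathlib's `AlgebraicGeometry/Modules`).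
set_option backward.isDefEq.respectTransparency false

open CategoryTheory AlgebraicGeometry Opposite TopologicalSpace

universe u

namespace Literature.AlgebraicGeometry.Modules

variable {X : Scheme.{u}} {P G : X.Modules}

/-! ### Evaluation of a morphism `P|_V → G|_V` on `V`-sections -/

section Eval

variable (P G) (V : X.Opens)

/-- **Evaluation on `V`-sections**: `φ ↦ (s ↦ φ_V(s))`, linear over `𝒪(V)` in `φ` and in `s`.
[cite: Hartshorne1977, II Prop. 5.2 (p. 110)] -/
def evalHom : (P.over V ⟶ G.over V) →ₗ[Γ(X, V)] (Γ(P, V) →ₗ[Γ(X, V)] Γ(G, V)) where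
  toFun φ :=
    { toFun := fun s => appLE φ (𝟙 V) s
      map_add' := fun s t => appLE_add_right φ (𝟙 V) s t
      map_smul' := fun r s => appLE_smul_right φ (𝟙 V) r s }
  map_add' φ ψ := by
    ext s
    exact appLE_add φ ψ (𝟙 V) s
  map_smul' a φ := by
    ext s
    change appLE (a • φ) (𝟙 V) s = a • appLE φ (𝟙 V) s
    rw [appLE_smul]
    congr 1
    change (X.presheaf.map (𝟙 (op V))) a = a
    rw [X.presheaf.map_id]
    rfl

variable {P G V}

/-- Unfolding `evalHom`. [folklore] -/
@[simp]
theorem evalHom_apply (φ : P.over V ⟶ G.over V) (s : Γ(P, V)) : evalHom P G V φ s = appLE φ (𝟙 V) s :=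
  rfl

/-- Evaluation on `W`-sections of a morphism over `V ≥ W` is evaluation of its restriction.
[folklore] -/
theorem evalHom_restrictHom_apply {W : X.Opens} (i : W ⟶ V) (φ : P.over V ⟶ G.over V) (s : Γ(P, W)) :
    evalHom P G W (restrictHom i φ) s = appLE φ i s := by
  rw [evalHom_apply, appLE_restrictHom, Category.id_comp]

/-- Naturality of evaluation: `φ_W(s|_W) = φ_V(s)|_W`. [folklore] -/
theorem evalHom_restrictHom_map {W : X.Opens} (i : W ⟶ V) (φ : P.over V ⟶ G.over V) (s : Γ(P, V)) :
    evalHom P G W (restrictHom i φ) (P.presheaf.map i.op s) = G.presheaf.map i.op (evalHom P G V φ s) := by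
  rw [evalHom_restrictHom_apply, evalHom_apply, ← appLE_map, Category.comp_id]

end Eval

/-! ### Restrictions to principal opens: bookkeeping -/

section Basic

variable {V : X.Opens}

/-- Multiplication by a power of `g|_Y` is injective on `Γ(G, Y)` for `Y ⊆ D(g)`. [folklore] -/
theorem pow_smul_injective (M : X.Modules) {U Y : X.Opens} (g : Γ(X, U)) (hY : Y ≤ X.basicOpen g)
    (n : ℕ) : Function.Injective fun t : Γ(M, Y) =>
      X.presheaf.map (homOfLE (hY.trans (X.basicOpen_le g))).op g ^ n • t :=
  (sections_pow_smul_bijective_of_le_basicOpen M g hY n).1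

end Basic

/-! ### Injectivity of evaluation -/

section Injective

variable {V : X.Opens}

/-- **A morphism `P|_V → G|_V` killing `Γ(V, P)` is zero** (`P` affine-localizing, `V` affine):
sections of `P` over a principal open `D(g) ⊆ V` are fractions `x|_{D(g)}/gⁿ`, so `φ` kills them,
and every open `W ⊆ V` is covered by such `D(g)`. [cite: Hartshorne1977, II Prop. 5.2 (p. 110)] -/
theorem evalHom_injective (hP : IsAffineLocalizing P) (hV : IsAffineOpen V) :
    Function.Injective (evalHom P G V) := by
  intro φ ψ hφψ
  have h0 : ∀ x : Γ(P, V), appLE φ (𝟙 V) x = appLE ψ (𝟙 V) x := fun x => LinearMap.congr_fun hφψ x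
  refine hom_ext_of_appLE fun W k s => ?_
  -- cover `W` by the principal opens `D(g) ⊆ W` of `V`
  let ι := {g : Γ(X, V) // X.basicOpen g ≤ W}
  let U : ι → X.Opens := fun g => X.basicOpen g.1
  have hcov : W ≤ iSup U := fun x hx => by
    obtain ⟨g, hgW, hxg⟩ := hV.exists_basicOpen_le ⟨x, hx⟩ (k.le hx)
    exact Opens.mem_iSup.mpr ⟨⟨g, hgW⟩, hxg⟩
  refine TopCat.Sheaf.eq_of_locally_eq' ((SheafOfModules.toSheaf _).obj G) U W
    (fun g => homOfLE g.2) hcov _ _ fun g => ?_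
  change G.presheaf.map (homOfLE g.2).op (appLE φ k s) = G.presheaf.map (homOfLE g.2).op (appLE ψ k s)
  rw [← appLE_map, ← appLE_map]
  -- numerator of `s|_{D(g)}`: `x|_{D(g)} = gⁿ s|_{D(g)}`
  obtain ⟨n, x, hx⟩ := hP.numerator hV g.1 (W := X.basicOpen g.1) rfl (P.presheaf.map (homOfLE g.2).op s)
  apply pow_smul_injective G g.1 le_rfl n
  dsimp only
  rw [← appLE_smul_right, ← appLE_smul_right]
  have e : homOfLE g.2 ≫ k = homOfLE (X.basicOpen_le g.1) ≫ 𝟙 V := Subsingleton.elim _ _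
  rw [e]
  change appLE φ _ (X.presheaf.map (homOfLE (X.basicOpen_le g.1)).op g.1 ^ n •
      P.presheaf.map (homOfLE g.2).op s) =
    appLE ψ _ (X.presheaf.map (homOfLE (X.basicOpen_le g.1)).op g.1 ^ n •
      P.presheaf.map (homOfLE g.2).op s)
  rw [← hx, appLE_map, appLE_map, h0]

end Injective

/-! ### Surjectivity of evaluation: extending a linear map on `V`-sections -/

section Surjective

variable (hP : IsAffineLocalizing P) {V : X.Opens} (hV : IsAffineOpen V)
  (ℓ : Γ(P, V) →ₗ[Γ(X, V)] Γ(G, V))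

/-- Shorthand: restriction of sections of `M` from `V` to `D(g)`. [folklore] -/
abbrev resD (M : X.Modules) (g : Γ(X, V)) : Γ(M, V) →+ Γ(M, X.basicOpen g) :=
  (M.presheaf.map (homOfLE (X.basicOpen_le g)).op).hom

/-- Shorthand: restriction of functions from `V` to `D(g)`. [folklore] -/
abbrev resDR (g : Γ(X, V)) : Γ(X, V) →+* Γ(X, X.basicOpen g) :=
  (X.presheaf.map (homOfLE (X.basicOpen_le g)).op).hom

omit hP hV in
/-- `(b • y)|_{D(g)} = b|_{D(g)} • y|_{D(g)}`. [folklore] -/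
theorem resD_smul (M : X.Modules) (g b : Γ(X, V)) (y : Γ(M, V)) :
    resD M g (b • y) = resDR g b • resD M g y :=
  M.map_smul (homOfLE (X.basicOpen_le g)) b y

omit hP hV in
/-- Restricting `x|_{D(g)}` further to `D(h) ⊆ D(g)` gives `x|_{D(h)}` (sections of a module;
`Modules/QcohLocalization.map_map`). [folklore] -/
theorem map_resD (M : X.Modules) {g h : Γ(X, V)} (hle : X.basicOpen h ≤ X.basicOpen g) (x : Γ(M, V)) :
    M.presheaf.map (homOfLE hle).op (resD M g x) = resD M h x :=
  (map_map M _ _ x).trans rfl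

omit hP hV in
/-- Restricting `r|_{D(g)}` further to `D(h) ⊆ D(g)` gives `r|_{D(h)}` (functions;
`Modules/QcohLocalization.ringMap_map`). [folklore] -/
theorem map_resDR {g h : Γ(X, V)} (hle : X.basicOpen h ≤ X.basicOpen g) (r : Γ(X, V)) :
    X.presheaf.map (homOfLE hle).op (resDR g r) = resDR h r :=
  (ringMap_map (X := X) _ _ r).trans rfl

include hP hV in
/-- **Key cancellation** (torsion property of `P`): if `(b • y)|_{D(h)} = (b' • y')|_{D(h)}` in
`Γ(D(h), P)` then `(b • ℓ y)|_{D(h)} = (b' • ℓ y')|_{D(h)}` in `Γ(D(h), G)` — some `hᴺ` kills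
`b y - b' y'`, apply `ℓ`, restrict, and cancel the unit `h|_{D(h)}`.
[cite: Hartshorne1977, II Lemma 5.3 (p. 112)] -/
theorem resD_smul_linear_eq (h b b' : Γ(X, V)) (y y' : Γ(P, V))
    (e : resD P h (b • y) = resD P h (b' • y')) :
    resD G h (b • ℓ y) = resD G h (b' • ℓ y') := by
  obtain ⟨n, hn⟩ := hP.torsion hV h (b • y - b' • y') (X.basicOpen_le h) le_rfl (by
    change resD P h (b • y - b' • y') = 0
    rw [map_sub, e, sub_self])
  have h1 : h ^ n • (b • ℓ y - b' • ℓ y') = 0 := by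
    rw [← map_smul ℓ b y, ← map_smul ℓ b' y', ← map_sub, ← map_smul, hn, map_zero]
  have h2 : resDR h h ^ n • (resD G h (b • ℓ y) - resD G h (b' • ℓ y')) = 0 := by
    have := congrArg (resD G h) h1
    rw [map_zero, resD_smul, map_sub, map_pow] at this
    exact this
  apply sub_eq_zero.mp
  apply pow_smul_injective G h le_rfl n
  dsimp only
  rw [smul_zero]
  exact h2

/-- The chosen exponent of a numerator of `s ∈ Γ(D(g), P)`. [folklore] -/
def numExp (g : Γ(X, V)) (s : Γ(P, X.basicOpen g)) : ℕ :=
  (hP.numerator hV g (W := X.basicOpen g) rfl s).choose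

/-- The chosen numerator `x ∈ Γ(V, P)` of `s ∈ Γ(D(g), P)`: `x|_{D(g)} = gⁿ s`. [folklore] -/
def num (g : Γ(X, V)) (s : Γ(P, X.basicOpen g)) : Γ(P, V) :=
  (hP.numerator hV g (W := X.basicOpen g) rfl s).choose_spec.choose

/-- The defining property of the chosen numerator. [folklore] -/
theorem resD_num (g : Γ(X, V)) (s : Γ(P, X.basicOpen g)) :
    resD P g (num hP hV g s) = resDR g g ^ numExp hP hV g s • s :=
  (hP.numerator hV g (W := X.basicOpen g) rfl s).choose_spec.choose_spec

/-- The unit `g|_{D(g)}` of `Γ(D(g), 𝒪_X)`. [folklore] -/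
def unitD (g : Γ(X, V)) : (Γ(X, X.basicOpen g))ˣ :=
  (isUnit_map_of_le_basicOpen g (le_refl (X.basicOpen g))).unit

omit hP hV in
/-- The unit `g|_{D(g)}` is the restriction of `g`. [folklore] -/
theorem val_unitD (g : Γ(X, V)) : (unitD g : Γ(X, X.basicOpen g)) = resDR g g :=
  rfl

/-- **The local value** of the sought morphism on `s ∈ Γ(D(g), P)`: `ℓ(x)|_{D(g)} / gⁿ` for the
chosen numerator `x|_{D(g)} = gⁿ s`. [cite: Hartshorne1977, II Prop. 5.2 (p. 110)] -/
def locVal (g : Γ(X, V)) (s : Γ(P, X.basicOpen g)) : Γ(G, X.basicOpen g) :=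
  (((unitD g ^ numExp hP hV g s)⁻¹ : (Γ(X, X.basicOpen g))ˣ) : Γ(X, X.basicOpen g)) •
    resD G g (ℓ (num hP hV g s))

/-- `gⁿ •` the local value is `ℓ(x)|_{D(g)}` for the CHOSEN numerator. [folklore] -/
theorem pow_smul_locVal (g : Γ(X, V)) (s : Γ(P, X.basicOpen g)) :
    resDR g g ^ numExp hP hV g s • locVal hP hV ℓ g s = resD G g (ℓ (num hP hV g s)) := by
  have hu : resDR g g ^ numExp hP hV g s =
      ((unitD g ^ numExp hP hV g s : (Γ(X, X.basicOpen g))ˣ) : Γ(X, X.basicOpen g)) := by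
    rw [Units.val_pow_eq_pow_val]; rfl
  rw [locVal, hu, smul_smul, Units.mul_inv, one_smul]

/-- **The local value is independent of the numerator**: `gᵐ • locVal s = ℓ(x')|_{D(g)}` for ANY
`x'|_{D(g)} = gᵐ s`. [cite: Hartshorne1977, II Lemma 5.3 (p. 112)] -/
theorem pow_smul_locVal_of_eq (g : Γ(X, V)) (s : Γ(P, X.basicOpen g)) (m : ℕ) (x' : Γ(P, V))
    (hx' : resD P g x' = resDR g g ^ m • s) :
    resDR g g ^ m • locVal hP hV ℓ g s = resD G g (ℓ x') := by
  -- `(gᵐ • x)|_{D(g)} = g^{m+n} s = (gⁿ • x')|_{D(g)}`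
  have e : resD P g (g ^ m • num hP hV g s) = resD P g (g ^ numExp hP hV g s • x') := by
    rw [resD_smul, resD_smul, map_pow, map_pow, resD_num, hx', smul_smul, smul_smul, pow_mul_comm]
  have key := resD_smul_linear_eq hP hV ℓ g (g ^ m) (g ^ numExp hP hV g s) (num hP hV g s) x' e
  rw [resD_smul, resD_smul, map_pow, map_pow] at key
  -- cancel `gⁿ`
  apply pow_smul_injective G g le_rfl (numExp hP hV g s)
  dsimp only
  change resDR g g ^ numExp hP hV g s • (resDR g g ^ m • locVal hP hV ℓ g s) =
    resDR g g ^ numExp hP hV g s • resD G g (ℓ x')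
  rw [smul_smul, pow_mul_comm, ← smul_smul, pow_smul_locVal, key]

/-- Uniqueness of the local value: a section `t` with `gᵐ • t = ℓ(x')|_{D(g)}` for SOME numerator
`x'|_{D(g)} = gᵐ s` is the local value. [folklore] -/
theorem eq_locVal (g : Γ(X, V)) (s : Γ(P, X.basicOpen g)) (m : ℕ) (x' : Γ(P, V))
    (hx' : resD P g x' = resDR g g ^ m • s) (t : Γ(G, X.basicOpen g))
    (ht : resDR g g ^ m • t = resD G g (ℓ x')) : t = locVal hP hV ℓ g s := by
  apply pow_smul_injective G g le_rfl m
  dsimp only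
  change resDR g g ^ m • t = resDR g g ^ m • locVal hP hV ℓ g s
  rw [ht, pow_smul_locVal_of_eq hP hV ℓ g s m x' hx']

/-- The local value is additive. [folklore] -/
theorem locVal_add (g : Γ(X, V)) (s s' : Γ(P, X.basicOpen g)) :
    locVal hP hV ℓ g (s + s') = locVal hP hV ℓ g s + locVal hP hV ℓ g s' := by
  symm
  set n := numExp hP hV g s
  set n' := numExp hP hV g s'
  refine eq_locVal hP hV ℓ g (s + s') (n + n') (g ^ n' • num hP hV g s + g ^ n • num hP hV g s') ?_ _ ?_
  · rw [map_add, resD_smul, resD_smul, map_pow, map_pow, resD_num, resD_num, smul_smul, smul_smul,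
      ← pow_add, ← pow_add, add_comm n' n, smul_add]
  · have h1 : resDR g g ^ (n + n') • locVal hP hV ℓ g s = resDR g g ^ n' • resD G g (ℓ (num hP hV g s)) := by
      rw [pow_add, mul_comm, ← smul_smul, pow_smul_locVal]
    have h2 : resDR g g ^ (n + n') • locVal hP hV ℓ g s' = resDR g g ^ n • resD G g (ℓ (num hP hV g s')) := by
      rw [pow_add, ← smul_smul, pow_smul_locVal]
    rw [smul_add, h1, h2, map_add ℓ, map_smul ℓ, map_smul ℓ, map_add, resD_smul, resD_smul, map_pow,
      map_pow]

/-- The local value is `Γ(D(g), 𝒪_X)`-linear. [folklore] -/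
theorem locVal_smul (g : Γ(X, V)) (r : Γ(X, X.basicOpen g)) (s : Γ(P, X.basicOpen g)) :
    locVal hP hV ℓ g (r • s) = r • locVal hP hV ℓ g s := by
  haveI := hV.isLocalization_basicOpen g
  -- `r = b|/gᵐ`
  obtain ⟨⟨b, ⟨_, m, rfl⟩⟩, hb⟩ := IsLocalization.surj (Submonoid.powers g) (S := Γ(X, X.basicOpen g)) r
  change r * algebraMap Γ(X, V) Γ(X, X.basicOpen g) (g ^ m) = algebraMap Γ(X, V) Γ(X, X.basicOpen g) b at hb
  have hb' : r * resDR g g ^ m = resDR g b := by rw [← map_pow]; exact hb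
  symm
  set n := numExp hP hV g s
  refine eq_locVal hP hV ℓ g (r • s) (m + n) (b • num hP hV g s) ?_ _ ?_
  · rw [resD_smul, resD_num, smul_smul, ← hb', smul_smul, pow_add]
    congr 1
    ring
  · rw [map_smul ℓ, resD_smul, ← hb', ← pow_smul_locVal, smul_smul, smul_smul, pow_add]
    congr 1
    ring

/-- **Locality of the local values**: for `D(h) ⊆ D(g)`, the local value on `D(g)` restricts to the
local value on `D(h)`. [cite: Hartshorne1977, II Lemma 5.3 (p. 112)] -/
theorem map_locVal {g h : Γ(X, V)} (hle : X.basicOpen h ≤ X.basicOpen g) (s : Γ(P, X.basicOpen g)) :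
    G.presheaf.map (homOfLE hle).op (locVal hP hV ℓ g s) =
      locVal hP hV ℓ h (P.presheaf.map (homOfLE hle).op s) := by
  set n := numExp hP hV g s
  set n' := numExp hP hV h (P.presheaf.map (homOfLE hle).op s)
  -- on `D(h)`: `(gⁿ • x')| = gⁿ h^{n'} s| = (h^{n'} • x)|`
  have e : resD P h (g ^ n • num hP hV h (P.presheaf.map (homOfLE hle).op s)) =
      resD P h (h ^ n' • num hP hV g s) := by
    rw [resD_smul, resD_smul, map_pow, map_pow, resD_num]
    rw [← map_resD P hle, resD_num, P.map_smul, map_pow, map_resDR, smul_smul, smul_smul, mul_comm]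
  have key := resD_smul_linear_eq hP hV ℓ h (g ^ n) (h ^ n') _ _ e
  rw [resD_smul, resD_smul, map_pow, map_pow] at key
  -- the restricted value has the characteristic property of `locVal h s'` for the numerator `x'`
  refine (eq_locVal hP hV ℓ h _ n' _ (resD_num hP hV h _) _ ?_).symm ▸ rfl
  apply pow_smul_injective G g hle n
  dsimp only
  change resDR h g ^ n • (resDR h h ^ n' • G.presheaf.map (homOfLE hle).op (locVal hP hV ℓ g s)) =
    resDR h g ^ n • resD G h (ℓ (num hP hV h (P.presheaf.map (homOfLE hle).op s)))
  rw [key, smul_comm]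
  congr 1
  have h3 : resDR h g ^ n = X.presheaf.map (homOfLE hle).op (resDR g g ^ n) := by
    rw [map_pow, map_resDR]
  rw [h3, ← G.map_smul, pow_smul_locVal, map_resD]

/-! #### Gluing the local values over an open `W ⊆ V` -/

variable (W : X.Opens)

/-- The principal opens of `V` inside `W`. [folklore] -/
def BIdx (W : X.Opens) : Type u := {g : Γ(X, V) // X.basicOpen g ≤ W}

/-- The cover of `W` by the principal opens of `V` inside it. [folklore] -/
def bCover (W : X.Opens) : BIdx (V := V) W → X.Opens := fun g => X.basicOpen g.1

include hV in
omit hP in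
/-- `W ⊆ V` is covered by the principal opens of `V` inside it. [folklore] -/
theorem le_iSup_bCover (hW : W ≤ V) : W ≤ iSup (bCover (V := V) W) := fun x hx => by
  obtain ⟨g, hgW, hxg⟩ := hV.exists_basicOpen_le ⟨x, hx⟩ (hW hx)
  exact Opens.mem_iSup.mpr ⟨⟨g, hgW⟩, hxg⟩

/-- The local pieces of the value at `s ∈ Γ(W, P)`. [folklore] -/
def pieces (s : Γ(P, W)) (g : BIdx (V := V) W) : Γ(G, bCover W g) :=
  locVal hP hV ℓ g.1 (P.presheaf.map (homOfLE g.2).op s)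

/-- The local pieces are compatible on overlaps `D(g) ∩ D(g') = D(gg')`. [folklore] -/
theorem pieces_compatible (s : Γ(P, W)) (i j : BIdx (V := V) W) :
    G.presheaf.map (Opens.infLELeft (bCover W i) (bCover W j)).op (pieces hP hV ℓ W s i) =
      G.presheaf.map (Opens.infLERight (bCover W i) (bCover W j)).op (pieces hP hV ℓ W s j) := by
  have hmul : X.basicOpen (i.1 * j.1) = bCover W i ⊓ bCover W j := X.basicOpen_mul i.1 j.1
  have hl : X.basicOpen (i.1 * j.1) ≤ X.basicOpen i.1 := hmul.trans_le inf_le_left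
  have hr : X.basicOpen (i.1 * j.1) ≤ X.basicOpen j.1 := hmul.trans_le inf_le_right
  -- both sides, restricted to `D(g g')` along honest inequalities, are the local value there
  have hs : P.presheaf.map (homOfLE hl).op (P.presheaf.map (homOfLE i.2).op s) =
      P.presheaf.map (homOfLE hr).op (P.presheaf.map (homOfLE j.2).op s) :=
    (map_map P (homOfLE i.2).op (homOfLE hl).op s).trans
      (map_map P (homOfLE j.2).op (homOfLE hr).op s).symm
  have H : G.presheaf.map (homOfLE hl).op (pieces hP hV ℓ W s i) =
      G.presheaf.map (homOfLE hr).op (pieces hP hV ℓ W s j) := by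
    simp only [pieces]
    rw [map_locVal hP hV ℓ hl, map_locVal hP hV ℓ hr, hs]
  have key : ∀ (O : X.Opens) (h₁ : O ≤ X.basicOpen i.1) (h₂ : O ≤ X.basicOpen j.1),
      O ≤ X.basicOpen (i.1 * j.1) →
      G.presheaf.map (homOfLE h₁).op (pieces hP hV ℓ W s i) =
        G.presheaf.map (homOfLE h₂).op (pieces hP hV ℓ W s j) := by
    intro O h₁ h₂ h₃
    have e₁ : G.presheaf.map (homOfLE h₁).op (pieces hP hV ℓ W s i) =
        G.presheaf.map (homOfLE h₃).op (G.presheaf.map (homOfLE hl).op (pieces hP hV ℓ W s i)) :=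
      (map_map G (homOfLE hl).op (homOfLE h₃).op _).symm
    have e₂ : G.presheaf.map (homOfLE h₂).op (pieces hP hV ℓ W s j) =
        G.presheaf.map (homOfLE h₃).op (G.presheaf.map (homOfLE hr).op (pieces hP hV ℓ W s j)) :=
      (map_map G (homOfLE hr).op (homOfLE h₃).op _).symm
    rw [e₁, e₂, H]
  exact key _ inf_le_left inf_le_right hmul.ge

include hV in
/-- Existence and uniqueness of the glued value at `s ∈ Γ(W, P)`, `W ⊆ V`. [folklore] -/
theorem existsUnique_value (hW : W ≤ V) (s : Γ(P, W)) :
    ∃! t : Γ(G, W), ∀ g : BIdx (V := V) W,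
      G.presheaf.map (homOfLE g.2).op t = pieces hP hV ℓ W s g :=
  TopCat.Sheaf.existsUnique_gluing' ((SheafOfModules.toSheaf _).obj G) (bCover W) W
    (fun g => homOfLE g.2) (le_iSup_bCover hV W hW) (pieces hP hV ℓ W s)
    (pieces_compatible hP hV ℓ W s)

/-- **The value** of the sought morphism at `s ∈ Γ(W, P)` (`W ⊆ V`): the section of `G` over `W`
glued from the local values on the principal opens `D(g) ⊆ W`.
[cite: Hartshorne1977, II Prop. 5.2 (p. 110)] -/
def value (hW : W ≤ V) (s : Γ(P, W)) : Γ(G, W) :=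
  (existsUnique_value hP hV ℓ W hW s).choose

/-- The value restricts to the local values. [folklore] -/
theorem map_value (hW : W ≤ V) (s : Γ(P, W)) (g : BIdx (V := V) W) :
    G.presheaf.map (homOfLE g.2).op (value hP hV ℓ W hW s) = pieces hP hV ℓ W s g :=
  (existsUnique_value hP hV ℓ W hW s).choose_spec.1 g

/-- Uniqueness of the value. [folklore] -/
theorem value_unique (hW : W ≤ V) (s : Γ(P, W)) {t : Γ(G, W)}
    (ht : ∀ g : BIdx (V := V) W, G.presheaf.map (homOfLE g.2).op t = pieces hP hV ℓ W s g) :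
    t = value hP hV ℓ W hW s :=
  (existsUnique_value hP hV ℓ W hW s).choose_spec.2 t ht

/-- The value is additive. [folklore] -/
theorem value_add (hW : W ≤ V) (s s' : Γ(P, W)) :
    value hP hV ℓ W hW (s + s') = value hP hV ℓ W hW s + value hP hV ℓ W hW s' := by
  symm
  refine value_unique hP hV ℓ W hW _ fun g => ?_
  rw [map_add, map_value, map_value, pieces, pieces, pieces, map_add, locVal_add]

/-- The value is `𝒪(W)`-linear. [folklore] -/
theorem value_smul (hW : W ≤ V) (r : Γ(X, W)) (s : Γ(P, W)) :
    value hP hV ℓ W hW (r • s) = r • value hP hV ℓ W hW s := by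
  symm
  refine value_unique hP hV ℓ W hW _ fun g => ?_
  rw [G.map_smul, map_value, pieces, pieces, P.map_smul, locVal_smul]

/-- The value is compatible with restriction. [folklore] -/
theorem map_value_eq {W' : X.Opens} (hW : W ≤ V) (l : W' ≤ W) (s : Γ(P, W)) :
    G.presheaf.map (homOfLE l).op (value hP hV ℓ W hW s) =
      value hP hV ℓ W' (l.trans hW) (P.presheaf.map (homOfLE l).op s) := by
  refine value_unique hP hV ℓ W' (l.trans hW) _ fun g => ?_
  rw [map_map G, pieces, map_map P]
  exact map_value hP hV ℓ W hW s ⟨g.1, g.2.trans l⟩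

/-- On `V` itself the value is `ℓ`. [folklore] -/
theorem value_top (s : Γ(P, V)) : value hP hV ℓ V le_rfl s = ℓ s := by
  symm
  refine value_unique hP hV ℓ V le_rfl s fun g => ?_
  rw [pieces]
  -- numerator `(0, s)` of `s|_{D(g)}`
  refine eq_locVal hP hV ℓ g.1 _ 0 s ?_ _ ?_
  · rw [pow_zero, one_smul]
  · rw [pow_zero, one_smul]

/-- **The morphism `P|_V → G|_V` with prescribed values `ℓ` on `V`-sections** (`P` affine-localizing,
`V` affine). [cite: Hartshorne1977, II Prop. 5.2 (p. 110)] -/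
def homOfLinear : P.over V ⟶ G.over V where
  val := PresheafOfModules.homMk
    { app := fun W => AddCommGrpCat.ofHom
        { toFun := fun s => value hP hV ℓ W.unop.left W.unop.hom.le s
          map_zero' := by
            have h := value_add hP hV ℓ W.unop.left W.unop.hom.le (0 : Γ(P, W.unop.left)) 0
            rw [add_zero] at h
            exact (left_eq_add.mp h).symm ▸ rfl
          map_add' := fun s s' => value_add hP hV ℓ W.unop.left W.unop.hom.le s s' }
      naturality := fun {W W'} f => by
        ext s
        change value hP hV ℓ W'.unop.left W'.unop.hom.le ((P.over V).val.map f s) =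
          (G.over V).val.map f (value hP hV ℓ W.unop.left W.unop.hom.le s)
        change value hP hV ℓ W'.unop.left W'.unop.hom.le (P.presheaf.map f.unop.left.op s) =
          G.presheaf.map f.unop.left.op (value hP hV ℓ W.unop.left W.unop.hom.le s)
        have hl : W'.unop.left ≤ W.unop.left := f.unop.left.le
        rw [show f.unop.left = homOfLE hl from Subsingleton.elim _ _,
          map_value_eq hP hV ℓ W.unop.left W.unop.hom.le hl s] }
    (fun W r s => value_smul hP hV ℓ W.unop.left W.unop.hom.le r s)

/-- The values of `homOfLinear`. [folklore] -/
@[simp]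
theorem appLE_homOfLinear {W : X.Opens} (k : W ⟶ V) (s : Γ(P, W)) :
    appLE (homOfLinear hP hV ℓ) k s = value hP hV ℓ W k.le s := rfl

/-- **`homOfLinear ℓ` evaluates to `ℓ` on `V`-sections.** [cite: Hartshorne1977, II Prop. 5.2 (p. 110)] -/
theorem evalHom_homOfLinear : evalHom P G V (homOfLinear hP hV ℓ) = ℓ := by
  ext s
  rw [evalHom_apply, appLE_homOfLinear]
  exact value_top hP hV ℓ s

include hP hV in
/-- **Surjectivity of evaluation.** [cite: Hartshorne1977, II Prop. 5.2 (p. 110)] -/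
theorem evalHom_surjective : Function.Surjective (evalHom P G V) := fun ℓ =>
  ⟨homOfLinear hP hV ℓ, evalHom_homOfLinear hP hV ℓ⟩

include hP hV in
/-- **`Hom(P|_V, G|_V) = Hom_{𝒪(V)}(Γ(V, P), Γ(V, G))`** for `P` affine-localizing and `V` affine
(Hartshorne II Prop. 5.2 / Stacks 01I7 in the affine-local language).
[cite: Hartshorne1977, II Prop. 5.2 (p. 110)] [cite: StacksProject, Tag 01I7] -/
theorem evalHom_bijective : Function.Bijective (evalHom P G V) :=
  ⟨evalHom_injective hP hV, evalHom_surjective hP hV⟩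

/-- The linear equivalence `Hom(P|_V, G|_V) ≃ Hom_{𝒪(V)}(Γ(V, P), Γ(V, G))`. [folklore] -/
def evalEquiv : (P.over V ⟶ G.over V) ≃ₗ[Γ(X, V)] (Γ(P, V) →ₗ[Γ(X, V)] Γ(G, V)) :=
  LinearEquiv.ofBijective (evalHom P G V) (evalHom_bijective hP hV)

/-- Unfolding `evalEquiv`. [folklore] -/
@[simp]
theorem evalEquiv_apply (φ : P.over V ⟶ G.over V) : evalEquiv hP hV φ = evalHom P G V φ := rfl

end Surjective

end Literature.AlgebraicGeometry.Modules

end
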